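import Summits.BirchSwinnertonDyer.Rank1Residual.X12.ClassClosureO10RubinEta
import Literature.NumberTheory.EllipticCurves.ManinConstantQuadraticTwistIstarProofs
import Literature.NumberTheory.DiophantineGeometry.TateAlgorithmRingEquivProofs
import HarnessLib

/-!
# Rung W-ALL (D-0120), row 12 · K12i: the Manin cell of route `BiquadraticEisensteinDescent` at
# `p ∈ {5, 7}` — the `Iₙ*` sub-cell is CLOSED IN THE TREE, the residual is the supercuspidal cell
# (cell `bsd-wall`, lane 2, seat ty-2; alt-closers BY NAME, Theses-free)

HONEST FRAMING (cell `bsd-wall`, run/shared/lean/pub/bsd-wall/; WALL-BRIEF-v1 §2). NOTHING ASSERTED: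
no `def`, no `@[conjecture]`, no named fact, no route file imported; W-ALL is OPEN and this file
proves bookkeeping only. Route `route-BirchSwinnertonDyer-BiquadraticEisensteinDescent` (seat
bsd-wall-cm; `Theses/BiquadraticEisensteinDescent.lean`, closes target
`Summit.BirchSwinnertonDyer.WAllCornerFInertBad`) consumes, inside its ATTACKED conjunct (CM,
`r_an = 1`, `p ≥ 5` inert in the CM field, `p ∣ N`), a Manin datum `p ∤ c(D)` for the optimal
parametrisation datum `D` of the strong curve: at `p > 7` from Edixhoven 1991 Thm. 3 + Deuring
(`X12.not_dvd_maninConstant_of_hasCM_of_not_cmSplit_of_optimal`), at `p ∈ {5, 7}` from its item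
stmt-BirchSwinnertonDyer-20242 `ManinDatumFiveSevenCMInert` (declared residual; "no published
argument removes 5, 7 for additive CM fibres"). This file records, BY NAME and with the item's shape
RE-TYPED VERBATIM (the route file is not importable into lane 2), that HALF of that item is already a
theorem of the tree:

* `maninDatum_of_kodairaSymbolAt_eq_Istar` — **Kodaira type `Iₙ*` at an odd `p` ⟹ `p ∤ c(D)`** for
  a lattice-optimal `X₀(N)`-datum `D`, modulo the four named facts `hM` (Mazur 1978 Cor. 4.1),
  `hAU` (Abbes–Ullmo 1996 Thm. A), `hC2` (Česnavičius 2018, `2 ∥ N`), `hnf` (modularity: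
  `exists_isNewformOf`): the tree theorem
  `Literature.NumberTheory.EllipticCurves.ModularForms.not_dvd_maninConstant_of_kodairaSymbolAt_eq_Istar`
  (`ManinConstantQuadraticTwistIstarProofs.lean`: the "Mazur and Stevens" clause of Edixhoven 1991
  §1 — the `q*`-twist of a type-`I₀*` curve is good at `q`, Stevens 1989 Lemmas (5.2)/(5.4) PROVED
  in the tree — valid at EVERY odd prime, no `p > 7`), re-keyed to "the place of `ℤ` under `p`".
* `kodairaSymbolAt_cases_of_cmInert_of_not_good_five_seven` — **for a CM curve with `p ∈ {5, 7}`
  inert in the CM field and bad, the Kodaira type at `p` is `Iₙ*`, or `p = 5 ∧ j = 0 ∧ type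
  ∈ {II, IV, IV*, II*}`, or `p = 7 ∧ j = 1728 ∧ type ∈ {III, III*}`** — the X12 cell's
  classification `X12.signedLocalType_cases` (`hasGoodReductionAt_or_kodairaSymbolAt_of_hasCM`:
  `j ∉ {0, 1728}` ⟹ `I₀*`; `j = 0` ⟹ `p ≡ 2 (3)`, so not `7`; `j = 1728` ⟹ `p ≡ 3 (4)`, so not
  `5`), transported from the place of `𝓞 ℚ` to the place of `ℤ` (`kodairaSymbolAt_eq_padic`).
* `maninDatumFiveSevenCMInert_of_facts_of_supercuspidalResidual` — **item 20242 (verbatim) ⇐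
  `hM`, `hAU`, `hC2`, `hnf` + the SUPERCUSPIDAL RESIDUAL**: the item's own shape with the extra
  hypothesis `(p = 5 ∧ j = 0 ∧ type ∈ {II, IV, IV*, II*}) ∨ (p = 7 ∧ j = 1728 ∧ type ∈ {III, III*})`
  (semistability defect `e ∈ {3, 6}` resp. `e = 4`; the curves `y² = x³ + B`, `v₅(B) ∈ {1,2,4,5}`,
  and `y² = x³ + Ax`, `v₇(A) ∈ {1, 3}`); `supercuspidalResidual_of_maninDatumFiveSevenCMInert` is the
  converse and `maninDatumFiveSevenCMInert_iff_supercuspidalResidual` the exactness.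
* `maninDatum_fiveSeven_of_cmInert_of_j_ne` — the closed half per pair: `p = 5 ∧ j ≠ 0` or
  `p = 7 ∧ j ≠ 1728` ⟹ `p ∤ c(D)` (mod the four facts).

COUNTS (instrument readings of record, numbers not adjectives). CORE universe of the route's
conjunct line (N < 2·10⁴, CM, `r = 1`, `p ≥ 5` inert-bad; bsd-cm N13-O10SC-SCOPE.md §5,
`bsd-cm-inert/n13/O10SC-core47.tsv` f024599ce467bfe5): 72 pairs = PS (`I₀*`) 25 + SC 47; at
`p ∈ {5, 7}` the SC pairs — the residual of this file — are 27 = 21 @5 (`j = 0`; `e = 3`: 12,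
`e = 6`: 9: 225a1, 900c1, 2700h1, 2700l1, 3600bd1, 3600be1, 6075a1, 6075b1, 6075bc1, 6075bd1,
10800cr1, 10800cv1, 10800di1, 10800dl1, 11025a1, 11025k1, 11025l1, 14400a1, 14400df1, 14400dm1,
14400m1) + 6 @7 (`j = 1728`, `e = 4`: 3136u1, 3136v1, 12544i1, 12544j1, 14112bj1, 14112bk1); every
PS pair at `p ∈ {5, 7}` has its Manin datum closed here. RESIDUE universe of record (R196.10, 146
O10 cells N < 5·10⁵, `class-closure/O10/E2-hypotheses.tsv`): 48 cells at `p ∈ {5, 7}` = `I₀*` 22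
(6 @5, all `j ∉ {0,1728}`; 16 @7) CLOSED here + 26 @7 of type III (13) / III* (13) residual; no
`j = 0` cell @5 is residue there (MN19 per-pair certificates). Typed ≠ proved ≠ endorsed; no census
number moves; the route's other items are untouched.

References: `Theses/BiquadraticEisensteinDescent.lean` (items 20239–20244; NOT imported);
`Literature/…/ManinConstantQuadraticTwistIstarProofs.lean`; `X12/InertBadKodairaTypes.lean`,
`X12/InertBadLocalTypes.lean`, `X12/ClassClosureO10RubinEta.lean`; [cite: EdixhovenManin1991, §1
(typescript L96–101, L119–121) and Thm. 3]; [cite: Stevens1989, Lemmas (5.2), (5.4)];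
[cite: Mazur1978, Cor. 4.1]; [cite: Cesnavicius2018, Thm. 1.2]; [cite: SilvermanATAEC1994, IV.9.4
Table 4.1 and IV.11.1 table p. 368]; WALL-BRIEF-v1.md §2; HOME/bsd-wall-ty-2/README.md §10.
-/

noncomputable section

open scoped Classical NumberField

open WeierstrassCurve NumberField IsDedekindDomain IsDedekindDomain.HeightOneSpectrum
  Rat.HeightOneSpectrum Literature.NumberTheory.DiophantineGeometry
  Literature.NumberTheory.EllipticCurves Literature.NumberTheory.EllipticCurves.Rank1Residual
  Literature.NumberTheory.EllipticCurves.ModularForms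

set_option autoImplicit false

namespace Summit.BirchSwinnertonDyer.Rank1Residual.WAll

open Summit.BirchSwinnertonDyer.Rank1Residual.X12.O10 (HasSignedLocalType signedLocalType_cases)

/-! ## §0 The place of `ℤ` and the place of `𝓞 ℚ` under `p` carry the same Kodaira symbol -/

/-- Tate's algorithm at the place of `ℤ` under `p` and at the place of `𝓞 ℚ` under `p` return the
same symbol: both are the Kodaira symbol of `W ⊗ ℚ_p` over `ℤ_p` (`kodairaSymbolAt_eq_padic`).
[cite: SilvermanATAEC1994, IV.9.4 (PDF pp. 344–346)] -/
private theorem kodairaSymbolAt_int_eq_ringOfIntegers (W : WeierstrassCurve ℚ) [W.IsElliptic]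
    (v : HeightOneSpectrum ℤ) (v' : HeightOneSpectrum (𝓞 ℚ))
    (h : natGenerator v = natGenerator v') : W.kodairaSymbolAt v = W.kodairaSymbolAt v' := by
  let e : Nat.Primes → KodairaSymbol := fun q ↦
    haveI : Fact q.1.Prime := ⟨q.2⟩
    (W.baseChange ℚ_[q]).kodairaSymbol ℤ_[q]
  have h1 : W.kodairaSymbolAt v = e (primesEquiv v) := W.kodairaSymbolAt_eq_padic v
  have h2 : W.kodairaSymbolAt v' = e (primesEquiv v') := W.kodairaSymbolAt_eq_padic v'
  have h3 : primesEquiv v = primesEquiv v' := Subtype.ext h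
  rw [h1, h2, h3]

/-! ## §1 The `Iₙ*` sub-cell: CLOSED in the tree modulo four named facts -/

/-- **Kodaira type `Iₙ*` at an odd prime `p` ⟹ `p ∤ c(D)`** for a lattice-optimal `X₀(N)`-datum
`D` of a globally minimal `W` (any `W`, CM or not; any `n ≥ 0`), modulo Mazur 1978 Cor. 4.1 (`hM`),
Abbes–Ullmo 1996 (`hAU`), Česnavičius 2018 at `2 ∥ N` (`hC2`) and modularity (`hnf`): the tree
theorem `not_dvd_maninConstant_of_kodairaSymbolAt_eq_Istar` (the twist `W ⊗ χ_{p*}` is good, resp.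
multiplicative, at `p`; Stevens 1989 Lemma (5.2) proved in the tree), keyed to any place `v` of `ℤ`
with `natGenerator v = p`. [cite: EdixhovenManin1991, §1 (typescript L96–101)]
[cite: Stevens1989, Lemmas (5.2), (5.4)] [cite: Mazur1978, Cor. 4.1] [cite: Cesnavicius2018, Thm. 1.2] -/
theorem maninDatum_of_kodairaSymbolAt_eq_Istar
    (hM : mazur_not_dvd_maninConstant_of_odd)
    (hAU : abbesUllmo_not_dvd_maninConstant_of_not_dvd_level)
    (hC2 : cesnavicius_not_two_dvd_maninConstant_of_two_dvd_level)
    (hnf : exists_isNewformOf)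
    (W : WeierstrassCurve ℚ) [W.IsElliptic] [W.IsGloballyMinimal] {N : ℕ} [NeZero N]
    (D : ModularParametrizationData W N)
    (hopt : ∀ z ∈ D.L.lattice, ∃ w ∈ periodLattice D.f, z = D.c * w)
    (p : ℕ) [hp : Fact p.Prime] (hp2 : p ≠ 2)
    (v : HeightOneSpectrum ℤ) (hv : natGenerator v = p) {n : ℕ}
    (hK : W.kodairaSymbolAt v = .Istar n) : ¬ (p : ℤ) ∣ D.c := by
  have hvp : v = (primesEquiv (R := ℤ)).symm ⟨p, hp.out⟩ :=
    (Equiv.eq_symm_apply _).mpr (Subtype.ext hv)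
  rw [hvp] at hK
  exact not_dvd_maninConstant_of_kodairaSymbolAt_eq_Istar hM hAU hC2 hnf D hopt hp.out hp2 hK

/-! ## §2 The CM inert-bad Kodaira types at `p ∈ {5, 7}` -/

/-- **The local types of a CM curve at an inert bad `p ∈ {5, 7}`.** For `W/ℚ` with CM, `p ∈ {5,7}`
inert in the CM field and `W` bad at `p`, at the place `v` of `ℤ` under `p`: the Kodaira type is
`Iₙ*` (in fact `I₀*`: the principal-series cell, every `j`), or `p = 5`, `j = 0` and the type is
`II, IV, IV*` or `II*` (semistability defect `6, 3, 3, 6`), or `p = 7`, `j = 1728` and the type is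
`III` or `III*` (defect `4`). From the X12 cell's `signedLocalType_cases` (`j = 0` forces
`p ≡ 2 (mod 3)`, excluding `7`; `j = 1728` forces `p ≡ 3 (mod 4)`, excluding `5`), transported to
the place of `ℤ`. [cite: SilvermanATAEC1994, IV.9.4, Table 4.1 and App. A §3]
[cite: Cox2013, Prop. 5.16 and Cor. 5.17] -/
theorem kodairaSymbolAt_cases_of_cmInert_of_not_good_five_seven (W : WeierstrassCurve ℚ)
    [W.IsElliptic] (p : ℕ) [hp : Fact p.Prime] (hCM : W.HasCM) (hin : CMInert W p)
    (hbad : ¬ Good W p) (h57 : p = 5 ∨ p = 7) (v : HeightOneSpectrum ℤ) (hv : natGenerator v = p) :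
    (∃ n : ℕ, W.kodairaSymbolAt v = .Istar n) ∨
      (p = 5 ∧ W.j = 0 ∧ (W.kodairaSymbolAt v = .II ∨ W.kodairaSymbolAt v = .IV ∨
        W.kodairaSymbolAt v = .IVstar ∨ W.kodairaSymbolAt v = .IIstar)) ∨
      (p = 7 ∧ W.j = 1728 ∧ (W.kodairaSymbolAt v = .III ∨ W.kodairaSymbolAt v = .IIIstar)) := by
  -- the place of `𝓞 ℚ` under `p`, where the X12 classification is stated
  set v' : HeightOneSpectrum (𝓞 ℚ) := (primesEquiv (R := 𝓞 ℚ)).symm ⟨p, hp.out⟩ with hv'def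
  have hv' : natGenerator v' = p :=
    congrArg Subtype.val ((primesEquiv (R := 𝓞 ℚ)).apply_symm_apply ⟨p, hp.out⟩)
  have hT : HasSignedLocalType W p (W.kodairaSymbolAt v') := by
    refine ⟨hCM, hin, hbad, fun w hw ↦ ?_⟩
    have hww : w = v' := (primesEquiv (R := 𝓞 ℚ)).injective (Subtype.ext (hw.trans hv'.symm))
    rw [hww]
  have hbr : W.kodairaSymbolAt v = W.kodairaSymbolAt v' :=
    kodairaSymbolAt_int_eq_ringOfIntegers W v v' (hv.trans hv'.symm)
  rw [hbr]
  rcases signedLocalType_cases W p hT (by omega) v' hv' with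
    ⟨hj, hmod, hk⟩ | ⟨hj, hmod, hk⟩ | ⟨-, -, hk⟩
  · -- `j = 0`, `p ≡ 2 (mod 3)`: `p = 5`
    have hp5 : p = 5 := by omega
    rcases hk with h | h | h | h | h
    · exact Or.inr (Or.inl ⟨hp5, hj, Or.inl h⟩)
    · exact Or.inr (Or.inl ⟨hp5, hj, Or.inr (Or.inl h)⟩)
    · exact Or.inl ⟨0, h⟩
    · exact Or.inr (Or.inl ⟨hp5, hj, Or.inr (Or.inr (Or.inl h))⟩)
    · exact Or.inr (Or.inl ⟨hp5, hj, Or.inr (Or.inr (Or.inr h))⟩)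
  · -- `j = 1728`, `p ≡ 3 (mod 4)`: `p = 7`
    have hp7 : p = 7 := by omega
    rcases hk with h | h | h
    · exact Or.inr (Or.inr ⟨hp7, hj, Or.inl h⟩)
    · exact Or.inl ⟨0, h⟩
    · exact Or.inr (Or.inr ⟨hp7, hj, Or.inr h⟩)
  · exact Or.inl ⟨0, hk⟩

/-- **The closed half per pair: `p = 5 ∧ j ≠ 0`, or `p = 7 ∧ j ≠ 1728` ⟹ `p ∤ c(D)`** for a CM curve
inert-bad at `p` and a lattice-optimal datum `D` (mod `hM`, `hAU`, `hC2`, `hnf`): such a pair is of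
type `I₀*`. In particular every congruent-number curve `y² = x³ − n²x` at `p ∣ n`, `p ≡ 3 (4)`, and
every CM curve with `j ∉ {0, 1728}`. [cite: EdixhovenManin1991, §1 (typescript L96–101)]
[cite: Stevens1989, Lemmas (5.2), (5.4)] -/
theorem maninDatum_fiveSeven_of_cmInert_of_j_ne
    (hM : mazur_not_dvd_maninConstant_of_odd)
    (hAU : abbesUllmo_not_dvd_maninConstant_of_not_dvd_level)
    (hC2 : cesnavicius_not_two_dvd_maninConstant_of_two_dvd_level)
    (hnf : exists_isNewformOf)
    (W : WeierstrassCurve ℚ) [W.IsElliptic] [W.IsGloballyMinimal] {N : ℕ} [NeZero N]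
    (D : ModularParametrizationData W N)
    (hopt : ∀ z ∈ D.L.lattice, ∃ w ∈ periodLattice D.f, z = D.c * w)
    (p : ℕ) [hp : Fact p.Prime] (hCM : W.HasCM) (hin : CMInert W p) (hbad : ¬ Good W p)
    (h57 : (p = 5 ∧ W.j ≠ 0) ∨ (p = 7 ∧ W.j ≠ 1728)) : ¬ (p : ℤ) ∣ D.c := by
  set v : HeightOneSpectrum ℤ := (primesEquiv (R := ℤ)).symm ⟨p, hp.out⟩ with hvdef
  have hv : natGenerator v = p :=
    congrArg Subtype.val ((primesEquiv (R := ℤ)).apply_symm_apply ⟨p, hp.out⟩)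
  have h57' : p = 5 ∨ p = 7 := h57.elim (fun h ↦ Or.inl h.1) (fun h ↦ Or.inr h.1)
  rcases kodairaSymbolAt_cases_of_cmInert_of_not_good_five_seven W p hCM hin hbad h57' v hv
    with ⟨n, hK⟩ | ⟨hp5, hj, -⟩ | ⟨hp7, hj, -⟩
  · exact maninDatum_of_kodairaSymbolAt_eq_Istar hM hAU hC2 hnf W D hopt p (by omega) v hv hK
  · rcases h57 with ⟨-, hj0⟩ | ⟨hp7, -⟩
    · exact absurd hj hj0
    · omega
  · rcases h57 with ⟨hp5, -⟩ | ⟨-, hj1⟩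
    · omega
    · exact absurd hj hj1

/-! ## §3 Item 20242 from the four facts and the supercuspidal residual; exactness -/

/-- **Route `BiquadraticEisensteinDescent`'s item `ManinDatumFiveSevenCMInert` (stmt-…-20242, shape
VERBATIM) from four named facts and its SUPERCUSPIDAL RESIDUAL.** The residual is the item's own
statement restricted to the pairs of semistability defect `e ∈ {3, 4, 6}`: `p = 5`, `j = 0`, type
`II/IV/IV*/II*` at `5`, or `p = 7`, `j = 1728`, type `III/III*` at `7` (at the place `v` of `ℤ`
under `p`); the principal-series pairs (`I₀*`, every `j`) are discharged by
`maninDatum_of_kodairaSymbolAt_eq_Istar`. The four facts are the named inputs of the tree's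
semistable Manin theorem (`hM` Mazur 1978 Cor. 4.1, `hAU` Abbes–Ullmo 1996 Thm. A, `hC2`
Česnavičius 2018 Thm. 1.2 at `2 ∥ N`) and modularity (`hnf`). [cite: EdixhovenManin1991, §1 and
Thm. 3] [cite: Stevens1989, Lemmas (5.2), (5.4)] [cite: Mazur1978, Cor. 4.1]
[cite: Cesnavicius2018, Thm. 1.2] -/
theorem maninDatumFiveSevenCMInert_of_facts_of_supercuspidalResidual
    (hM : mazur_not_dvd_maninConstant_of_odd)
    (hAU : abbesUllmo_not_dvd_maninConstant_of_not_dvd_level)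
    (hC2 : cesnavicius_not_two_dvd_maninConstant_of_two_dvd_level)
    (hnf : exists_isNewformOf)
    (hRes : ∀ (W : WeierstrassCurve ℚ) [W.IsElliptic] [W.IsGloballyMinimal]
      [NeZero (W.conductorNorm ℤ)] (p : ℕ) [Fact p.Prime]
      (D : ModularParametrizationData W (W.conductorNorm ℤ)) (v : HeightOneSpectrum ℤ),
      natGenerator v = p → W.HasCM → W.analyticRank = 1 → (p = 5 ∨ p = 7) → CMInert W p →
      ¬ Good W p → (∀ z ∈ D.L.lattice, ∃ w ∈ periodLattice D.f, z = D.c * w) →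
      (p = 5 ∧ W.j = 0 ∧ (W.kodairaSymbolAt v = .II ∨ W.kodairaSymbolAt v = .IV ∨
          W.kodairaSymbolAt v = .IVstar ∨ W.kodairaSymbolAt v = .IIstar)) ∨
        (p = 7 ∧ W.j = 1728 ∧ (W.kodairaSymbolAt v = .III ∨ W.kodairaSymbolAt v = .IIIstar)) →
      ¬ (p : ℤ) ∣ D.c) :
    ∀ (W : WeierstrassCurve ℚ) [W.IsElliptic] [W.IsGloballyMinimal] [NeZero (W.conductorNorm ℤ)]
      (p : ℕ) [Fact p.Prime] (D : ModularParametrizationData W (W.conductorNorm ℤ)),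
      W.HasCM → W.analyticRank = 1 → (p = 5 ∨ p = 7) → CMInert W p → ¬ Good W p →
      (∀ z ∈ D.L.lattice, ∃ w ∈ periodLattice D.f, z = D.c * w) → ¬ (p : ℤ) ∣ D.c := by
  intro W _ _ _ p hp D hCM hr h57 hin hbad hopt
  set v : HeightOneSpectrum ℤ := (primesEquiv (R := ℤ)).symm ⟨p, hp.out⟩ with hvdef
  have hv : natGenerator v = p :=
    congrArg Subtype.val ((primesEquiv (R := ℤ)).apply_symm_apply ⟨p, hp.out⟩)
  rcases kodairaSymbolAt_cases_of_cmInert_of_not_good_five_seven W p hCM hin hbad h57 v hv with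
    ⟨n, hK⟩ | hres
  · exact maninDatum_of_kodairaSymbolAt_eq_Istar hM hAU hC2 hnf W D hopt p (by omega) v hv hK
  · exact hRes W p D v hv hCM hr h57 hin hbad hopt hres

/-- **Converse: the item implies its supercuspidal residual** (drop the extra hypotheses).
Bookkeeping. [folklore] -/
theorem supercuspidalResidual_of_maninDatumFiveSevenCMInert
    (h : ∀ (W : WeierstrassCurve ℚ) [W.IsElliptic] [W.IsGloballyMinimal] [NeZero (W.conductorNorm ℤ)]
      (p : ℕ) [Fact p.Prime] (D : ModularParametrizationData W (W.conductorNorm ℤ)),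
      W.HasCM → W.analyticRank = 1 → (p = 5 ∨ p = 7) → CMInert W p → ¬ Good W p →
      (∀ z ∈ D.L.lattice, ∃ w ∈ periodLattice D.f, z = D.c * w) → ¬ (p : ℤ) ∣ D.c) :
    ∀ (W : WeierstrassCurve ℚ) [W.IsElliptic] [W.IsGloballyMinimal]
      [NeZero (W.conductorNorm ℤ)] (p : ℕ) [Fact p.Prime]
      (D : ModularParametrizationData W (W.conductorNorm ℤ)) (v : HeightOneSpectrum ℤ),
      natGenerator v = p → W.HasCM → W.analyticRank = 1 → (p = 5 ∨ p = 7) → CMInert W p →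
      ¬ Good W p → (∀ z ∈ D.L.lattice, ∃ w ∈ periodLattice D.f, z = D.c * w) →
      (p = 5 ∧ W.j = 0 ∧ (W.kodairaSymbolAt v = .II ∨ W.kodairaSymbolAt v = .IV ∨
          W.kodairaSymbolAt v = .IVstar ∨ W.kodairaSymbolAt v = .IIstar)) ∨
        (p = 7 ∧ W.j = 1728 ∧ (W.kodairaSymbolAt v = .III ∨ W.kodairaSymbolAt v = .IIIstar)) →
      ¬ (p : ℤ) ∣ D.c :=
  fun W _ _ _ p _ D _ _ hCM hr h57 hin hbad hopt _ ↦ h W p D hCM hr h57 hin hbad hopt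

/-- **Exactness: modulo `hM`, `hAU`, `hC2`, `hnf`, item 20242 ⟺ its supercuspidal residual** — the
weakest statement route `BiquadraticEisensteinDescent` may declare as its Manin residual at
`p ∈ {5, 7}` without changing what it closes. [folklore] -/
theorem maninDatumFiveSevenCMInert_iff_supercuspidalResidual
    (hM : mazur_not_dvd_maninConstant_of_odd)
    (hAU : abbesUllmo_not_dvd_maninConstant_of_not_dvd_level)
    (hC2 : cesnavicius_not_two_dvd_maninConstant_of_two_dvd_level)
    (hnf : exists_isNewformOf) :
    (∀ (W : WeierstrassCurve ℚ) [W.IsElliptic] [W.IsGloballyMinimal] [NeZero (W.conductorNorm ℤ)]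
      (p : ℕ) [Fact p.Prime] (D : ModularParametrizationData W (W.conductorNorm ℤ)),
      W.HasCM → W.analyticRank = 1 → (p = 5 ∨ p = 7) → CMInert W p → ¬ Good W p →
      (∀ z ∈ D.L.lattice, ∃ w ∈ periodLattice D.f, z = D.c * w) → ¬ (p : ℤ) ∣ D.c) ↔
    (∀ (W : WeierstrassCurve ℚ) [W.IsElliptic] [W.IsGloballyMinimal]
      [NeZero (W.conductorNorm ℤ)] (p : ℕ) [Fact p.Prime]
      (D : ModularParametrizationData W (W.conductorNorm ℤ)) (v : HeightOneSpectrum ℤ),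
      natGenerator v = p → W.HasCM → W.analyticRank = 1 → (p = 5 ∨ p = 7) → CMInert W p →
      ¬ Good W p → (∀ z ∈ D.L.lattice, ∃ w ∈ periodLattice D.f, z = D.c * w) →
      (p = 5 ∧ W.j = 0 ∧ (W.kodairaSymbolAt v = .II ∨ W.kodairaSymbolAt v = .IV ∨
          W.kodairaSymbolAt v = .IVstar ∨ W.kodairaSymbolAt v = .IIstar)) ∨
        (p = 7 ∧ W.j = 1728 ∧ (W.kodairaSymbolAt v = .III ∨ W.kodairaSymbolAt v = .IIIstar)) →
      ¬ (p : ℤ) ∣ D.c) :=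
  ⟨fun h W _ _ _ p _ D v hv ↦ supercuspidalResidual_of_maninDatumFiveSevenCMInert h W p D v hv,
    fun h W _ _ _ p _ D ↦
      maninDatumFiveSevenCMInert_of_facts_of_supercuspidalResidual hM hAU hC2 hnf h W p D⟩

end Summit.BirchSwinnertonDyer.Rank1Residual.WAll

end
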